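import Literature.NumberTheory.Transcendental.ManyCurveStd
import HarnessLib

/-!
# `k`-lattice standard models: quotients `M/K₀` are again standard models (adapted coordinates, transport)

Topic `Literature/NumberTheory/Transcendental`; fourth file of the unit
`provefact-Literature.NumberTheory.Transcendental.H-0a3eb64689` (fact
`Literature.NumberTheory.Transcendental.HuberWustholzManyCurvePeriods`, `ManyCurvePeriods.lean`),
after `ManyCurveStd.lean`. It introduces NO named fact. It is the family counterpart of the
one-lattice `StdQuotients.lean` / `GaGmE.Std.QuotData` and of the `QuotData` section of the
two-lattice `TwoCurveStd.lean`: for the family standard models `M = 𝔾ₘ^β × P` of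
`ManyCurveStd.lean` (lattice family `L : J → PeriodPair`, class map `cls : γ → J`, push-out
matrix `κ`) and a connected algebraic subgroup `K₀ = H_{(A₀, C₀, Ξ₀)}`
(`GaGmEFam.Std.SubgroupData`), the quotient `M/K₀` is again a family standard model for the
SAME lattice family, in coordinates adapted to `K₀`.

## What is proved here (everything; no `sorry`, no new `def … : Prop`)

* `GaGmEFam.Std.classPart` — the class-`i` part `C₀,ᵢ = {c ∈ C₀ ; supp c ⊆ cls⁻¹(i)}` of a
  block-diagonal `C₀` (`restr_mem_classPart`: `C₀ = ⊕ᵢ C₀,ᵢ`);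
* `GaGmEFam.Std.QuotData` — coordinates of `Lie(M/K₀)`: a unimodular integer basis `q⁽ʲ⁾` of
  `A₀ ∩ ℤ^β`, and CLASS BY CLASS unimodular integer bases `c⁽ⁱ,ᵇ⁾` of `C₀,ᵢ ∩ ℤ^γ`
  (`GaGmE.exists_unimodular_basis` applied to each `C₀,ᵢ`), so that the quotient of
  `∏_b E_{cls b}` by the abelian part of `K₀` is `∏ᵢ Eᵢ^{nᵢ}` with the new block index
  `Σ i, Fin nᵢ` and class map `Sigma.fst` (`cls'`); a `ℚ̄`-basis `ξ⁽ᵉ⁾` of `Ξ₀` and the matrix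
  `κ'` (`nonempty_quotData`); the joint block family `cvv` is supported classwise (`cvv_supp`),
  lies in and spans `C₀` (`cvv_mem`, `cvv_span`) and is unimodular (`cvv_unimod`, gluing the
  classwise integer sections along `cls`);
* `Φ` (`ker Φ = Lie K₀`, onto, `dim Φ⁻¹(X) = dim X + dim K₀`, defined over `ℚ̄`:
  `Φ_eq_zero_iff`, `ker_Φ`, `Φ_surjective`, `finrank_comap`, `card_eq`, `comap_map`, `Φ_ofK`,
  `isKRational_map`), `pull`/`comap_tangent` (block-diagonality is preserved: `isBlockDiag_map`),
  `tangent_le_pull`, `pull_ne_top`, `Φ_mem_AlgTors` (the new `z`-coordinates of class `i` are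
  integer combinations of old `z`-coordinates of class `i` only:
  `PeriodPair.IsUnivExtAlgPoint.sum_int_mul` over the blocks of ONE class),
  `exists_ker_of_Φ_mem_ker` (lift of the kernel), `transport` (image of a semistable `𝔟` by a
  BORDERLINE `K₀` is rational, proper, semistable — modular law and the mediant inequality,
  verbatim from `GaGmE.Std.QuotData.transport`);
* `QuotData.cls'_eq_imp` — if the CM classes carry at most one block of `M`, they carry at most
  one block of `M/K₀` (unimodularity of the classwise bases), so the hypotheses under which the
  classification of the algebraic subgroups is faithful pass to the quotient.

## References

* A. Baker, G. Wüstholz, *Logarithmic Forms and Diophantine Geometry*, New Math. Monogr. 9, CUP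
  2007: §6.7 (index, semistability), §6.8 (p. 115: passage to quotients; p. 117: division
  points). [BakerWustholz2007]
* A. Huber, G. Wüstholz, *Transcendence and Linear Relations of 1-Periods*, Cambridge Tracts 227,
  CUP 2022: Thm. 15.3 (1) (p. 145), Thm. 6.2. [HuberWustholz2022]
-/

noncomputable section

open Complex Module Submodule

namespace Literature.NumberTheory.Transcendental

namespace GaGmEFam

namespace Std

open GaGmE (Kbar exists_unimodular_basis linearIndependent_ofK isAlgebraic_cexp_rat_mul
  int_eq_zero_of_forall_dvd coords_eq_zero_of_forall exists_common_den)
open GaGmE.Std (iy iz is coords coords_iy coords_iz coords_is sum_blocks)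

variable {J : Type} {β γ δ : Type}

/-! ### The class parts of a block-diagonal subspace -/

section ClassPart

variable (cls : γ → J)

/-- The class-`i` part of `C`: the vectors of `C` supported in the blocks of class `i`.
[folklore] -/
def classPart (C : Submodule ℚ (γ → ℚ)) (i : J) : Submodule ℚ (γ → ℚ) where
  carrier := {c | c ∈ C ∧ ∀ k, cls k ≠ i → c k = 0}
  add_mem' := by
    rintro a b ⟨ha, ha'⟩ ⟨hb, hb'⟩
    exact ⟨C.add_mem ha hb, fun k hk => by simp [ha' k hk, hb' k hk]⟩
  zero_mem' := ⟨C.zero_mem, fun _ _ => rfl⟩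
  smul_mem' := by
    rintro r a ⟨ha, ha'⟩
    exact ⟨C.smul_mem r ha, fun k hk => by simp [ha' k hk]⟩

/-- Membership in the class part. [folklore] -/
theorem mem_classPart {C : Submodule ℚ (γ → ℚ)} {i : J} {c : γ → ℚ} :
    c ∈ classPart cls C i ↔ c ∈ C ∧ ∀ k, cls k ≠ i → c k = 0 :=
  Iff.rfl

/-- The class restrictions of a vector of a block-diagonal `C` lie in the class parts.
[folklore] -/
theorem restr_mem_classPart [DecidableEq J] {C : Submodule ℚ (γ → ℚ)} (hC : IsBlockDiag cls C)
    {c : γ → ℚ}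
    (hc : c ∈ C) (i : J) : restr cls i c ∈ classPart cls C i :=
  ⟨hC c hc i, fun _ hk => restr_apply_of_ne cls hk⟩

/-- Casting a rational span membership to `ℚ̄`. [folklore] -/
theorem cast_mem_span_of_mem_span {ι α : Type} [Fintype ι] {v : ι → α → ℤ} {q : α → ℚ}
    (h : q ∈ Submodule.span ℚ (Set.range fun j a => (v j a : ℚ))) :
    (fun a => (q a : Kbar)) ∈ Submodule.span Kbar (Set.range fun j a => (v j a : Kbar)) := by
  rw [Submodule.mem_span_range_iff_exists_fun] at h ⊢
  obtain ⟨r, hr⟩ := h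
  refine ⟨fun j => (r j : Kbar), ?_⟩
  funext a
  have := congr_fun hr a
  simp only [Finset.sum_apply, Pi.smul_apply, smul_eq_mul] at this ⊢
  rw [← this]
  push_cast
  rfl

end ClassPart

/-! ### Quotients `M/K₀` are again family standard models (adapted coordinates) -/

section Quot

variable [Fintype J] [DecidableEq J] [Fintype β] [Fintype γ] [Fintype δ] {cls : γ → J}
  {κM : δ → γ → Kbar}

/-- **Coordinates of `Lie(M/K₀)` adapted to `K₀ = H_{(A₀, C₀, Ξ₀)}`**: a unimodular integer basis
`q⁽ʲ⁾` of `A₀`, class by class unimodular integer bases `c⁽ⁱ,ᵇ⁾` of the class parts `C₀,ᵢ`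
(so that the quotient of `∏_b E_{cls b}` by the abelian part of `K₀` is again `∏ᵢ Eᵢ^{nᵢ}`,
block index `Σ i, Fin nᵢ`, class map `Sigma.fst`), a `ℚ̄`-basis `ξ⁽ᵉ⁾` of `Ξ₀`, and the matrix
`κ'` with `ξ⁽ᵉ⁾ ∘ κ = ∑_{(i,b)} κ'_{e,(i,b)} c⁽ⁱ,ᵇ⁾` (compatibility). The quotient `M/K₀` is
then the family standard model with Lie coordinates `y'_j = q⁽ʲ⁾ · y`, `z'_{(i,b)} = c⁽ⁱ,ᵇ⁾ · z`,
`s'_e = ξ⁽ᵉ⁾ · s` (as `GaGmE.Std.QuotData` for one lattice). [folklore] -/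
structure QuotData (D₀ : SubgroupData β γ δ cls κM) where
  /-- number of `𝔾ₘ`-coordinates of `M/K₀` -/
  nA : ℕ
  /-- the integer characters `q⁽ʲ⁾` -/
  qv : Fin nA → β → ℤ
  qv_mem : ∀ j, (fun i => (qv j i : ℚ)) ∈ D₀.A
  qv_span : ∀ q ∈ D₀.A, q ∈ Submodule.span ℚ (Set.range fun j i => (qv j i : ℚ))
  qv_unimod : ∀ t : Fin nA → ℤ, ∃ p : β → ℤ, ∀ j, ∑ i, qv j i * p i = t j
  /-- number of `Eᵢ`-coordinates of `M/K₀`, class by class -/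
  n : J → ℕ
  /-- the integer homomorphisms `c⁽ⁱ,ᵇ⁾ : ∏_b E_{cls b} → Eᵢ` -/
  cv : (i : J) → Fin (n i) → γ → ℤ
  cv_mem : ∀ i b, (fun k => (cv i b k : ℚ)) ∈ D₀.C
  cv_supp : ∀ i b k, cls k ≠ i → cv i b k = 0
  cv_span : ∀ i, ∀ c ∈ classPart cls D₀.C i,
    c ∈ Submodule.span ℚ (Set.range fun b k => (cv i b k : ℚ))
  cv_unimod : ∀ i (t : Fin (n i) → ℤ), ∃ p : γ → ℤ, ∀ b, ∑ k, cv i b k * p k = t b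
  /-- number of vector-group coordinates of `M/K₀` -/
  nΞ : ℕ
  /-- the additive characters `ξ⁽ᵉ⁾` -/
  ξv : Fin nΞ → δ → Kbar
  ξv_mem : ∀ e, ξv e ∈ D₀.Ξ
  ξv_span : ∀ ξ ∈ D₀.Ξ, ξ ∈ Submodule.span Kbar (Set.range ξv)
  ξv_indep : LinearIndependent Kbar ξv
  /-- the push-out matrix `κ'` of the quotient -/
  κM' : Fin nΞ → (Σ i, Fin (n i)) → Kbar
  κM'_spec : ∀ e k, ∑ e', ξv e e' * κM e' k = ∑ b : Σ i, Fin (n i), κM' e b * (cv b.1 b.2 k : Kbar)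

/-- Adapted coordinates exist. [folklore] -/
theorem nonempty_quotData (D₀ : SubgroupData β γ δ cls κM) : Nonempty (QuotData D₀) := by
  classical
  obtain ⟨nA, qv, qv_mem, qv_span, qv_unimod⟩ := exists_unimodular_basis D₀.A
  have hcls := fun i => exists_unimodular_basis (classPart cls D₀.C i)
  choose n cv hcv_mem hcv_span hcv_unimod using hcls
  have cv_mem : ∀ i b, (fun k => (cv i b k : ℚ)) ∈ D₀.C := fun i b => (hcv_mem i b).1
  have cv_supp : ∀ i b k, cls k ≠ i → cv i b k = 0 := fun i b k hk => by
    have h0 : ((cv i b k : ℤ) : ℚ) = 0 := (hcv_mem i b).2 k hk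
    exact_mod_cast h0
  -- a basis of `Ξ₀`
  let bΞ := Module.finBasis Kbar D₀.Ξ
  set nΞ := finrank Kbar D₀.Ξ
  let ξv : Fin nΞ → δ → Kbar := fun e => (bΞ e : δ → Kbar)
  have ξv_mem : ∀ e, ξv e ∈ D₀.Ξ := fun e => (bΞ e).2
  have ξv_span : ∀ ξ ∈ D₀.Ξ, ξ ∈ Submodule.span Kbar (Set.range ξv) := by
    intro ξ hξ
    have e : ξ = ∑ e, (bΞ.repr ⟨ξ, hξ⟩ e) • ξv e := by
      have h := congrArg (fun x : D₀.Ξ => (x : δ → Kbar)) (bΞ.sum_repr ⟨ξ, hξ⟩)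
      simp only [Submodule.coe_sum, Submodule.coe_smul] at h
      exact h.symm
    rw [e]
    exact Submodule.sum_mem _ fun e _ => Submodule.smul_mem _ _ (Submodule.subset_span ⟨e, rfl⟩)
  have ξv_indep : LinearIndependent Kbar ξv :=
    bΞ.linearIndependent.map' D₀.Ξ.subtype (Submodule.ker_subtype _)
  -- the matrix `κ'`: `ξv e ∘ κ ∈ span_K C₀ = span_K {joint block family}`
  have hspanC : Submodule.span Kbar ((fun c : γ → ℚ => fun k => (c k : Kbar)) ''
      (D₀.C : Set (γ → ℚ)))
      ≤ Submodule.span Kbar (Set.range fun (b : Σ i, Fin (n i)) k => (cv b.1 b.2 k : Kbar)) := by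
    rw [Submodule.span_le]
    rintro _ ⟨c, hc, rfl⟩
    have e : (fun k => (c k : Kbar)) = ∑ i, fun k => ((restr cls i c k : ℚ) : Kbar) := by
      funext k
      simp only [Finset.sum_apply]
      have := congr_fun (sum_restr cls c) k
      rw [Finset.sum_apply] at this
      rw [← this]
      push_cast
      rfl
    show (fun k => (c k : Kbar)) ∈ _
    rw [e]
    refine Submodule.sum_mem _ fun i _ => ?_
    have hi := cast_mem_span_of_mem_span
      (hcv_span i _ (restr_mem_classPart cls D₀.blockDiag hc i))
    refine Submodule.span_mono ?_ hi
    rintro _ ⟨b, rfl⟩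
    exact ⟨⟨i, b⟩, rfl⟩
  have hκ : ∀ e, ∃ r : (Σ i, Fin (n i)) → Kbar,
      (∑ b, r b • fun k => (cv b.1 b.2 k : Kbar)) = fun k => ∑ e', ξv e e' * κM e' k := by
    intro e
    have := hspanC (D₀.compat (ξv e) (ξv_mem e))
    rwa [Submodule.mem_span_range_iff_exists_fun] at this
  choose κM' hκM' using hκ
  refine ⟨⟨nA, qv, qv_mem, qv_span, qv_unimod, n, cv, cv_mem, cv_supp, hcv_span, hcv_unimod,
    nΞ, ξv, ξv_mem, ξv_span, ξv_indep, κM', fun e k => ?_⟩⟩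
  have := congr_fun (hκM' e) k
  simp only [Finset.sum_apply, Pi.smul_apply, smul_eq_mul] at this
  exact this.symm

namespace QuotData

variable {D₀ : SubgroupData β γ δ cls κM} (Q : QuotData D₀)

/-- The block index of `M/K₀`: class `i` has `nᵢ` blocks. [folklore] -/
abbrev B' : Type := Σ i, Fin (Q.n i)

/-- The class map of `M/K₀`. [folklore] -/
abbrev cls' : Q.B' → J := Sigma.fst

/-- The index type of the coordinates of `Lie(M/K₀)`. [folklore] -/
abbrev σ' : Type := Fin Q.nA ⊕ (Q.B' ⊕ Fin Q.nΞ)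

/-- The joint block family `c⁽ⁱ,ᵇ⁾` of the quotient data. [folklore] -/
def cvv (b : Q.B') : γ → ℤ := Q.cv b.1 b.2

/-- The joint block family, unfolded. [folklore] -/
theorem cvv_apply (b : Q.B') (k : γ) : Q.cvv b k = Q.cv b.1 b.2 k := rfl

/-- The rows of the joint block family are supported in their class. [folklore] -/
theorem cvv_supp {b : Q.B'} {k : γ} (h : cls k ≠ b.1) : Q.cvv b k = 0 :=
  Q.cv_supp b.1 b.2 k h

/-- The lattice on a block of the quotient: a row of the joint block family pairs the coordinates
of its own class only, so periods of `Λ_{cls k}` summed against it are periods of `Λ_{cls' b}`.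
[folklore] -/
theorem sum_cvv_cls (L : J → PeriodPair) (f₁ f₂ : PeriodPair → ℂ) (m n' : γ → ℤ) (b : Q.B') :
    ∑ k, (Q.cvv b k : ℂ) * (m k * f₁ (L (cls k)) + n' k * f₂ (L (cls k))) =
      ((∑ k, Q.cvv b k * m k : ℤ) : ℂ) * f₁ (L b.1) +
        ((∑ k, Q.cvv b k * n' k : ℤ) : ℂ) * f₂ (L b.1) := by
  push_cast
  rw [Finset.sum_mul, Finset.sum_mul, ← Finset.sum_add_distrib]
  refine Finset.sum_congr rfl fun k _ => ?_
  by_cases h : cls k = b.1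
  · rw [h]; ring
  · simp [Q.cvv_supp h]

/-- The rows of the joint block family lie in `C₀`. [folklore] -/
theorem cvv_mem (b : Q.B') : (fun k => (Q.cvv b k : ℚ)) ∈ D₀.C := Q.cv_mem b.1 b.2

/-- The rows of the joint block family span `C₀` over `ℚ` (class by class). [folklore] -/
theorem cvv_span (c : γ → ℚ) (hc : c ∈ D₀.C) :
    c ∈ Submodule.span ℚ (Set.range fun b k => (Q.cvv b k : ℚ)) := by
  rw [← sum_restr cls c]
  refine Submodule.sum_mem _ fun i _ => ?_
  have hi := Q.cv_span i _ (restr_mem_classPart cls D₀.blockDiag hc i)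
  refine Submodule.span_mono ?_ hi
  rintro _ ⟨b, rfl⟩
  exact ⟨⟨i, b⟩, rfl⟩

/-- The joint block family is unimodular: `p ↦ (c⁽ⁱ,ᵇ⁾ · p)` maps `ℤ^γ` onto `ℤ^{Σ nᵢ}` (glue
the classwise integer sections along `cls`). [folklore] -/
theorem cvv_unimod (t : Q.B' → ℤ) : ∃ p : γ → ℤ, ∀ b, ∑ k, Q.cvv b k * p k = t b := by
  choose p hp using fun i => Q.cv_unimod i fun j => t ⟨i, j⟩
  refine ⟨fun k => p (cls k) k, ?_⟩
  rintro ⟨i, j⟩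
  rw [← hp i j]
  refine Finset.sum_congr rfl fun k _ => ?_
  simp only [cvv_apply]
  by_cases h : cls k = i
  · rw [h]
  · simp [Q.cv_supp i j k h]

/-- The quotient map `Φ : Lie M → Lie(M/K₀)` in adapted coordinates. [folklore] -/
def Φ : (β ⊕ (γ ⊕ δ) → ℂ) →ₗ[ℂ] (Q.σ' → ℂ) where
  toFun w := coords (fun j => ∑ i, (Q.qv j i : ℂ) * w (iy i))
    (fun b => ∑ k, (Q.cvv b k : ℂ) * w (iz k))
    (fun e => ∑ e', (Q.ξv e e' : ℂ) * w (is e'))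
  map_add' v w := by
    funext x
    rcases x with j | b | e
    · simp only [coords, Sum.elim_inl, Pi.add_apply, mul_add, Finset.sum_add_distrib]
    · simp only [coords, Sum.elim_inr, Sum.elim_inl, Pi.add_apply, mul_add,
        Finset.sum_add_distrib]
    · simp only [coords, Sum.elim_inr, Pi.add_apply, mul_add, Finset.sum_add_distrib]
  map_smul' c w := by
    funext x
    rcases x with j | b | e
    · simp only [coords, Sum.elim_inl, Pi.smul_apply, smul_eq_mul, RingHom.id_apply,
        Finset.mul_sum]
      exact Finset.sum_congr rfl fun i _ => by ring
    · simp only [coords, Sum.elim_inr, Sum.elim_inl, Pi.smul_apply, smul_eq_mul,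
        RingHom.id_apply, Finset.mul_sum]
      exact Finset.sum_congr rfl fun i _ => by ring
    · simp only [coords, Sum.elim_inr, Pi.smul_apply, smul_eq_mul, RingHom.id_apply,
        Finset.mul_sum]
      exact Finset.sum_congr rfl fun i _ => by ring

/-- The `y'`-block of `Φ`. [folklore] -/
theorem Φ_iy (w) (j : Fin Q.nA) : Q.Φ w (iy j) = ∑ i, (Q.qv j i : ℂ) * w (iy i) := rfl
/-- The `z'`-block of `Φ`. [folklore] -/
theorem Φ_iz (w) (b : Q.B') : Q.Φ w (iz b) = ∑ k, (Q.cvv b k : ℂ) * w (iz k) := rfl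
/-- The `s'`-block of `Φ`. [folklore] -/
theorem Φ_is (w) (e : Fin Q.nΞ) : Q.Φ w (is e) = ∑ e', (Q.ξv e e' : ℂ) * w (is e') := rfl

/-- `ker Φ = Lie K₀`. [folklore] -/
theorem Φ_eq_zero_iff (w : β ⊕ (γ ⊕ δ) → ℂ) : Q.Φ w = 0 ↔ w ∈ D₀.tangent := by
  rw [SubgroupData.mem_tangent_iff]
  constructor
  · intro h
    have hy : ∀ j, ∑ i, (Q.qv j i : ℂ) * w (iy i) = 0 := fun j => by
      have := congr_fun h (iy j); rwa [Φ_iy] at this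
    have hz : ∀ b, ∑ k, (Q.cvv b k : ℂ) * w (iz k) = 0 := fun b => by
      have := congr_fun h (iz b); rwa [Φ_iz] at this
    have hs : ∀ e, ∑ e', (Q.ξv e e' : ℂ) * w (is e') = 0 :=
      fun e => by have := congr_fun h (is e); rwa [Φ_is] at this
    refine ⟨fun q hq => ?_, fun c hc => ?_, fun ξ hξ => ?_⟩
    · have hq' := Q.qv_span q hq
      rw [Submodule.mem_span_range_iff_exists_fun] at hq'
      obtain ⟨r, rfl⟩ := hq'
      simp only [Finset.sum_apply, Pi.smul_apply, smul_eq_mul, Rat.cast_sum, Rat.cast_mul,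
        Rat.cast_intCast, Finset.sum_mul]
      rw [Finset.sum_comm]
      refine Finset.sum_eq_zero fun j _ => ?_
      have := congrArg (fun x => (r j : ℂ) * x) (hy j)
      simpa [Finset.mul_sum, mul_assoc] using this
    · have hc' := Q.cvv_span c hc
      rw [Submodule.mem_span_range_iff_exists_fun] at hc'
      obtain ⟨r, rfl⟩ := hc'
      simp only [Finset.sum_apply, Pi.smul_apply, smul_eq_mul, Rat.cast_sum, Rat.cast_mul,
        Rat.cast_intCast, Finset.sum_mul]
      rw [Finset.sum_comm]
      refine Finset.sum_eq_zero fun b _ => ?_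
      have := congrArg (fun x => (r b : ℂ) * x) (hz b)
      rw [Finset.mul_sum, mul_zero] at this
      simpa only [mul_assoc] using this
    · have hξ' := Q.ξv_span ξ hξ
      rw [Submodule.mem_span_range_iff_exists_fun] at hξ'
      obtain ⟨r, rfl⟩ := hξ'
      have : ∑ e, (r e : ℂ) * (∑ e', (Q.ξv e e' : ℂ) * w (is e')) = 0 :=
        Finset.sum_eq_zero fun e _ => by rw [hs e, mul_zero]
      rw [← this]
      simp only [Finset.sum_apply, Pi.smul_apply, smul_eq_mul]
      push_cast
      simp only [Finset.sum_mul, Finset.mul_sum]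
      rw [Finset.sum_comm]
      exact Finset.sum_congr rfl fun e _ => Finset.sum_congr rfl fun k _ => by ring
  · rintro ⟨hA, hC, hΞ⟩
    funext x
    rcases x with j | b | e
    · show Q.Φ w (iy j) = 0
      rw [Φ_iy]
      simpa using hA _ (Q.qv_mem j)
    · show Q.Φ w (iz b) = 0
      rw [Φ_iz]
      simpa using hC _ (Q.cvv_mem b)
    · show Q.Φ w (is e) = 0
      rw [Φ_is]
      exact hΞ _ (Q.ξv_mem e)

/-- `ker Φ = Lie K₀` as submodules. [folklore] -/
theorem ker_Φ : LinearMap.ker Q.Φ = D₀.tangent := by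
  ext w
  rw [LinearMap.mem_ker, Φ_eq_zero_iff]

/-- `Φ` is surjective. [folklore] -/
theorem Φ_surjective : Function.Surjective Q.Φ := by
  classical
  intro x
  choose py hpy using fun j => Q.qv_unimod (Pi.single j 1)
  choose pz hpz using fun b => Q.cvv_unimod (Pi.single b 1)
  -- the `s`-block map is onto
  let Ψ : (δ → ℂ) →ₗ[ℂ] (Fin Q.nΞ → ℂ) :=
    { toFun := fun v e => ∑ s, (Q.ξv e s : ℂ) * v s
      map_add' := fun v v' => by
        funext e; simp [mul_add, Finset.sum_add_distrib]
      map_smul' := fun c v => by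
        funext e
        simp only [Pi.smul_apply, smul_eq_mul, RingHom.id_apply, Finset.mul_sum]
        exact Finset.sum_congr rfl fun s _ => by ring }
  have hΨs : ∀ s e, Ψ (Pi.single s 1) e = (Q.ξv e s : ℂ) := fun s e => by
    simp only [Ψ, LinearMap.coe_mk, AddHom.coe_mk]
    rw [Finset.sum_eq_single s (fun s' _ hs' => by simp [Pi.single_eq_of_ne hs'])
      (fun h => absurd (Finset.mem_univ s) h)]
    simp
  have hΨ : Function.Surjective Ψ := by
    rw [← LinearMap.range_eq_top]
    by_contra hne
    obtain ⟨f, hf0, hle⟩ := Submodule.exists_le_ker_of_lt_top _ (lt_top_iff_ne_top.mpr hne)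
    apply hf0
    let c : Fin Q.nΞ → ℂ := fun e => f (Pi.single e 1)
    have hf : ∀ u : Fin Q.nΞ → ℂ, f u = ∑ e, c e * u e := by
      intro u
      conv_lhs => rw [pi_eq_sum_univ u]
      simp only [map_sum, map_smul, smul_eq_mul, c]
      refine Finset.sum_congr rfl fun e _ => ?_
      rw [mul_comm]
      congr 2
      funext e'
      simp [Pi.single_apply, eq_comm]
    have hrel : ∑ e, c e • (fun s => (Q.ξv e s : ℂ)) = 0 := by
      funext s
      have hmem : Ψ (Pi.single s 1) ∈ LinearMap.range Ψ := LinearMap.mem_range_self _ _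
      have := hle hmem
      rw [LinearMap.mem_ker, hf] at this
      simp only [Finset.sum_apply, Pi.smul_apply, smul_eq_mul, Pi.zero_apply]
      rw [← this]
      exact Finset.sum_congr rfl fun e _ => by rw [hΨs]
    have hind := linearIndependent_ofK (L := ℂ) Q.ξv_indep
    have hc0 : ∀ e, c e = 0 := by
      have := Fintype.linearIndependent_iff.mp hind c (by
        rw [← hrel]
        refine Finset.sum_congr rfl fun e _ => ?_
        rfl)
      exact this
    refine LinearMap.ext fun u => ?_
    rw [hf]
    simp [hc0]
  obtain ⟨v, hv⟩ := hΨ fun e => x (is e)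
  refine ⟨coords (fun i => ∑ j, x (iy j) * (py j i : ℂ))
    (fun k => ∑ b, x (iz b) * (pz b k : ℂ)) v, ?_⟩
  funext s
  rcases s with j | b | e
  · show Q.Φ _ (iy j) = x (iy j)
    rw [Φ_iy]
    simp only [coords_iy]
    have key : ∀ j', ∑ i, (Q.qv j i : ℂ) * (py j' i : ℂ) = if j = j' then 1 else 0 := by
      intro j'
      have := hpy j' j
      have h := congrArg (fun n : ℤ => (n : ℂ)) this
      push_cast at h
      rw [h, Pi.single_apply]
      split_ifs <;> simp
    calc ∑ i, (Q.qv j i : ℂ) * ∑ j', x (iy j') * (py j' i : ℂ)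
        = ∑ j', x (iy j') * ∑ i, (Q.qv j i : ℂ) * (py j' i : ℂ) := by
          simp only [Finset.mul_sum]
          rw [Finset.sum_comm]
          exact Finset.sum_congr rfl fun j' _ => Finset.sum_congr rfl fun i _ => by ring
      _ = x (iy j) := by
          simp only [key, mul_ite, mul_one, mul_zero, Finset.sum_ite_eq, Finset.mem_univ, if_true]
  · show Q.Φ _ (iz b) = x (iz b)
    rw [Φ_iz]
    simp only [coords_iz]
    have key : ∀ b', ∑ k, (Q.cvv b k : ℂ) * (pz b' k : ℂ) = if b = b' then 1 else 0 := by
      intro b'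
      have := hpz b' b
      have h := congrArg (fun n : ℤ => (n : ℂ)) this
      push_cast at h
      rw [h, Pi.single_apply]
      split_ifs <;> simp
    calc ∑ k, (Q.cvv b k : ℂ) * ∑ b', x (iz b') * (pz b' k : ℂ)
        = ∑ b', x (iz b') * ∑ k, (Q.cvv b k : ℂ) * (pz b' k : ℂ) := by
          simp only [Finset.mul_sum]
          rw [Finset.sum_comm]
          exact Finset.sum_congr rfl fun b' _ => Finset.sum_congr rfl fun k _ => by ring
      _ = x (iz b) := by
          simp only [key, mul_ite, mul_one, mul_zero, Finset.sum_ite_eq, Finset.mem_univ, if_true]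
  · have := congr_fun hv e
    simp only [Ψ, LinearMap.coe_mk, AddHom.coe_mk] at this
    show Q.Φ _ (is e) = x (is e)
    rw [Φ_is]
    simp only [coords_is]
    exact this

/-- Dimension of preimages: `dim Φ⁻¹(X) = dim X + dim Lie K₀`. [folklore] -/
theorem finrank_comap (X : Submodule ℂ (Q.σ' → ℂ)) :
    finrank ℂ ↥(X.comap Q.Φ) = finrank ℂ X + finrank ℂ ↥D₀.tangent := by
  let Φ' := Q.Φ.domRestrict (X.comap Q.Φ)
  have hrange : LinearMap.range Φ' = X := by
    apply le_antisymm
    · rintro _ ⟨⟨w, hw⟩, rfl⟩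
      exact hw
    · intro x hx
      obtain ⟨w, rfl⟩ := Q.Φ_surjective x
      exact ⟨⟨w, hx⟩, rfl⟩
  have hker : finrank ℂ ↥(LinearMap.ker Φ') = finrank ℂ ↥D₀.tangent := by
    rw [LinearMap.ker_domRestrict, Q.ker_Φ]
    have hle : D₀.tangent ≤ X.comap Q.Φ := by
      intro w hw
      rw [Submodule.mem_comap, (Q.Φ_eq_zero_iff w).mpr hw]
      exact X.zero_mem
    exact (Submodule.comapSubtypeEquivOfLe hle).finrank_eq
  have := LinearMap.finrank_range_add_finrank_ker Φ'
  rw [hrange, hker] at this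
  exact this.symm

/-- `dim M = dim(M/K₀) + dim K₀`. [folklore] -/
theorem card_eq : Fintype.card (β ⊕ (γ ⊕ δ)) =
    Fintype.card Q.σ' + finrank ℂ ↥D₀.tangent := by
  have e1 : finrank ℂ ↥((⊤ : Submodule ℂ (Q.σ' → ℂ)).comap Q.Φ) =
      finrank ℂ (⊤ : Submodule ℂ (Q.σ' → ℂ)) + finrank ℂ ↥D₀.tangent := Q.finrank_comap ⊤
  rw [Submodule.comap_top, finrank_top, finrank_top, Module.finrank_fintype_fun_eq_card,
    Module.finrank_fintype_fun_eq_card] at e1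
  exact e1

/-- `Φ⁻¹(Φ(𝔟)) = 𝔟 + Lie K₀`. [folklore] -/
theorem comap_map (𝔟 : Submodule ℂ ((β ⊕ (γ ⊕ δ)) → ℂ)) :
    (𝔟.map Q.Φ).comap Q.Φ = 𝔟 ⊔ D₀.tangent := by
  rw [Submodule.comap_map_eq, Q.ker_Φ]

/-- The same map over `K = ℚ̄`. [folklore] -/
def ΦK (w : β ⊕ (γ ⊕ δ) → Kbar) : Q.σ' → Kbar :=
  coords (fun j => ∑ i, (Q.qv j i : Kbar) * w (iy i))
    (fun b => ∑ k, (Q.cvv b k : Kbar) * w (iz k))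
    (fun e => ∑ e', Q.ξv e e' * w (is e'))

/-- `Φ` is defined over `K`. [folklore] -/
theorem Φ_ofK (w : β ⊕ (γ ⊕ δ) → Kbar) :
    Q.Φ (LiePresentation.ofK Kbar w) = LiePresentation.ofK Kbar (Q.ΦK w) := by
  funext s
  rcases s with j | b | e
  · show ∑ i, (Q.qv j i : ℂ) * algebraMap Kbar ℂ (w (iy i)) =
      algebraMap Kbar ℂ (∑ i, (Q.qv j i : Kbar) * w (iy i))
    rw [map_sum]
    exact Finset.sum_congr rfl fun i _ => by rw [map_mul, map_intCast]
  · show ∑ k, (Q.cvv b k : ℂ) * algebraMap Kbar ℂ (w (iz k)) =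
      algebraMap Kbar ℂ (∑ k, (Q.cvv b k : Kbar) * w (iz k))
    rw [map_sum]
    exact Finset.sum_congr rfl fun k _ => by rw [map_mul, map_intCast]
  · show ∑ e', (Q.ξv e e' : ℂ) * algebraMap Kbar ℂ (w (is e')) =
      algebraMap Kbar ℂ (∑ e', Q.ξv e e' * w (is e'))
    rw [map_sum]
    exact Finset.sum_congr rfl fun e' _ => by rw [map_mul]; rfl

/-- Images of `K`-rational subspaces are `K`-rational. [folklore] -/
theorem isKRational_map {𝔟 : Submodule ℂ ((β ⊕ (γ ⊕ δ)) → ℂ)}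
    (h : LiePresentation.IsKRational Kbar 𝔟) : LiePresentation.IsKRational Kbar (𝔟.map Q.Φ) := by
  obtain ⟨S, rfl⟩ := h
  refine ⟨Q.ΦK '' S, ?_⟩
  rw [Submodule.map_span, Set.image_image, Set.image_image]
  congr 1
  exact Set.image_congr fun w _ => Q.Φ_ofK w

/-! #### Pull-back of subgroups of `M/K₀` to subgroups of `M` containing `K₀` -/

/-- The `ℚ`-linear map `q' ↦ ∑_j q'_j q⁽ʲ⁾`. [folklore] -/
def qLin : (Fin Q.nA → ℚ) →ₗ[ℚ] (β → ℚ) where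
  toFun q' := fun i => ∑ j, q' j * (Q.qv j i : ℚ)
  map_add' a b := by funext i; simp [add_mul, Finset.sum_add_distrib]
  map_smul' c a := by funext i; simp [Finset.mul_sum, mul_assoc]

/-- The `ℚ`-linear map `c' ↦ ∑_{(i,b)} c'_{(i,b)} c⁽ⁱ,ᵇ⁾` over the joint block family.
[folklore] -/
def cvvLin : (Q.B' → ℚ) →ₗ[ℚ] (γ → ℚ) where
  toFun c' := fun k => ∑ b, c' b * (Q.cvv b k : ℚ)
  map_add' a b := by
    funext i; simp only [Pi.add_apply, add_mul, Finset.sum_add_distrib]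
  map_smul' c a := by
    funext i; simp only [Pi.smul_apply, smul_eq_mul, RingHom.id_apply, Finset.mul_sum, mul_assoc]

/-- `cvvLin` commutes with the class restrictions (the rows of the joint family are supported
classwise). [folklore] -/
theorem restr_cvvLin (i : J) (c' : Q.B' → ℚ) :
    restr cls i (Q.cvvLin c') = Q.cvvLin (restr Q.cls' i c') := by
  funext k
  simp only [cvvLin, LinearMap.coe_mk, AddHom.coe_mk]
  by_cases hk : cls k = i
  · rw [restr_apply_of_eq cls hk]
    refine Finset.sum_congr rfl fun b _ => ?_
    by_cases hb : Q.cls' b = i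
    · rw [restr_apply_of_eq Q.cls' hb]
    · have : Q.cvv b k = 0 := Q.cvv_supp (by rw [hk]; exact Ne.symm hb)
      simp [restr_apply_of_ne Q.cls' hb, this]
  · rw [restr_apply_of_ne cls hk]
    symm
    refine Finset.sum_eq_zero fun b _ => ?_
    by_cases hb : Q.cls' b = i
    · have : Q.cvv b k = 0 := Q.cvv_supp (by rw [show b.1 = i from hb]; exact hk)
      simp [this]
    · simp [restr_apply_of_ne Q.cls' hb]

/-- **Block-diagonality is preserved**: the image of a block-diagonal subspace of `ℚ^{Σ nᵢ}`
under `cvvLin` is block-diagonal in `ℚ^γ`. [folklore] -/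
theorem isBlockDiag_map {C' : Submodule ℚ (Q.B' → ℚ)} (hC' : IsBlockDiag Q.cls' C') :
    IsBlockDiag cls (C'.map Q.cvvLin) := by
  rintro _ ⟨c', hc', rfl⟩ i
  rw [restr_cvvLin]
  exact Submodule.mem_map_of_mem (hC' c' hc' i)

/-- The `K`-linear map `ξ' ↦ ∑_e ξ'_e ξ⁽ᵉ⁾`. [folklore] -/
def ξLin : (Fin Q.nΞ → Kbar) →ₗ[Kbar] (δ → Kbar) where
  toFun ξ' := ∑ e, ξ' e • Q.ξv e
  map_add' a b := by simp [add_smul, Finset.sum_add_distrib]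
  map_smul' c a := by simp [Finset.smul_sum, smul_smul]

/-- The connected algebraic subgroup `K ⊇ K₀` of `M` corresponding to a connected algebraic
subgroup `K/K₀` of `M/K₀`. [folklore] -/
def pull (D' : SubgroupData (Fin Q.nA) Q.B' (Fin Q.nΞ) Q.cls' Q.κM') :
    SubgroupData β γ δ cls κM where
  A := D'.A.map Q.qLin
  C := D'.C.map Q.cvvLin
  blockDiag := Q.isBlockDiag_map D'.blockDiag
  Ξ := D'.Ξ.map Q.ξLin
  compat := by
    classical
    rintro _ ⟨ξ', hξ', rfl⟩
    have hc := D'.compat ξ' hξ'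
    -- `(ξLin ξ') ∘ κ = ∑_b (ξ' κ')_b • c⁽ᵇ⁾`
    have ht : (fun k => ∑ e', Q.ξLin ξ' e' * κM e' k) =
        ∑ b, (∑ e, ξ' e * Q.κM' e b) • fun k => (Q.cvv b k : Kbar) := by
      funext k
      have lhs : ∑ e', Q.ξLin ξ' e' * κM e' k = ∑ e, ξ' e * ∑ e', Q.ξv e e' * κM e' k := by
        simp only [ξLin, LinearMap.coe_mk, AddHom.coe_mk, Finset.sum_apply, Pi.smul_apply,
          smul_eq_mul, Finset.sum_mul, Finset.mul_sum]
        rw [Finset.sum_comm]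
        exact Finset.sum_congr rfl fun e _ => Finset.sum_congr rfl fun e' _ => by ring
      have rhs : (∑ b, (∑ e, ξ' e * Q.κM' e b) • fun k => (Q.cvv b k : Kbar)) k =
          ∑ e, ξ' e * ∑ b, Q.κM' e b * (Q.cvv b k : Kbar) := by
        simp only [Finset.sum_apply, Pi.smul_apply, smul_eq_mul, Finset.sum_mul, Finset.mul_sum]
        rw [Finset.sum_comm]
        exact Finset.sum_congr rfl fun e _ => Finset.sum_congr rfl fun b _ => by ring
      rw [lhs, rhs]
      exact Finset.sum_congr rfl fun e _ => by rw [Q.κM'_spec]; rfl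
    rw [ht]
    have key : ∀ lam ∈ Submodule.span Kbar
        ((fun c : Q.B' → ℚ => fun b => (c b : Kbar)) '' (D'.C : Set (Q.B' → ℚ))),
        (∑ b, lam b • fun k => (Q.cvv b k : Kbar)) ∈ Submodule.span Kbar
          ((fun c : γ → ℚ => fun k => (c k : Kbar)) ''
            ((D'.C.map Q.cvvLin : Submodule ℚ (γ → ℚ)) : Set (γ → ℚ))) := by
      intro lam hlam
      induction hlam using Submodule.span_induction with
      | mem x hx =>
        obtain ⟨c', hc', rfl⟩ := hx
        refine Submodule.subset_span ⟨Q.cvvLin c', Submodule.mem_map_of_mem hc', ?_⟩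
        funext k
        simp [cvvLin, Finset.sum_apply, Pi.smul_apply]
      | zero => simp
      | add x y _ _ hx hy =>
        simp only [Pi.add_apply, add_smul, Finset.sum_add_distrib]
        exact Submodule.add_mem _ hx hy
      | smul r x _ hx =>
        simp only [Pi.smul_apply, smul_eq_mul, ← smul_smul, ← Finset.smul_sum]
        exact Submodule.smul_mem _ _ hx
    exact key _ hc

/-- `Φ⁻¹(Lie(K/K₀)) = Lie K`. [folklore] -/
theorem comap_tangent (D' : SubgroupData (Fin Q.nA) Q.B' (Fin Q.nΞ) Q.cls' Q.κM') :
    D'.tangent.comap Q.Φ = (Q.pull D').tangent := by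
  ext w
  rw [Submodule.mem_comap, SubgroupData.mem_tangent_iff, SubgroupData.mem_tangent_iff]
  simp only [pull, Submodule.mem_map]
  constructor
  · rintro ⟨hA, hC, hΞ⟩
    refine ⟨?_, ?_, ?_⟩
    · rintro _ ⟨q', hq', rfl⟩
      have := hA q' hq'
      simp only [Φ_iy] at this
      simp only [qLin, LinearMap.coe_mk, AddHom.coe_mk, Rat.cast_sum, Rat.cast_mul,
        Rat.cast_intCast, Finset.sum_mul]
      rw [Finset.sum_comm, ← this]
      simp only [Finset.mul_sum]
      exact Finset.sum_congr rfl fun j _ => Finset.sum_congr rfl fun i _ => by ring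
    · rintro _ ⟨c', hc', rfl⟩
      have := hC c' hc'
      simp only [Φ_iz] at this
      simp only [cvvLin, LinearMap.coe_mk, AddHom.coe_mk, Rat.cast_sum, Rat.cast_mul,
        Rat.cast_intCast, Finset.sum_mul]
      rw [Finset.sum_comm, ← this]
      simp only [Finset.mul_sum]
      exact Finset.sum_congr rfl fun b _ => Finset.sum_congr rfl fun k _ => by ring
    · rintro _ ⟨ξ', hξ', rfl⟩
      have := hΞ ξ' hξ'
      simp only [Φ_is] at this
      rw [← this]
      simp only [ξLin, LinearMap.coe_mk, AddHom.coe_mk, Finset.sum_apply, Pi.smul_apply,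
        smul_eq_mul]
      push_cast
      simp only [Finset.sum_mul, Finset.mul_sum]
      rw [Finset.sum_comm]
      exact Finset.sum_congr rfl fun e _ => Finset.sum_congr rfl fun k _ => by ring
  · rintro ⟨hA, hC, hΞ⟩
    refine ⟨fun q' hq' => ?_, fun c' hc' => ?_, fun ξ' hξ' => ?_⟩
    · have := hA _ ⟨q', hq', rfl⟩
      simp only [qLin, LinearMap.coe_mk, AddHom.coe_mk, Rat.cast_sum, Rat.cast_mul,
        Rat.cast_intCast, Finset.sum_mul] at this
      rw [Finset.sum_comm] at this
      simp only [Φ_iy, Finset.mul_sum]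
      rw [← this]
      exact Finset.sum_congr rfl fun j _ => Finset.sum_congr rfl fun i _ => by ring
    · have := hC _ ⟨c', hc', rfl⟩
      simp only [cvvLin, LinearMap.coe_mk, AddHom.coe_mk, Rat.cast_sum, Rat.cast_mul,
        Rat.cast_intCast, Finset.sum_mul] at this
      rw [Finset.sum_comm] at this
      simp only [Φ_iz, Finset.mul_sum]
      rw [← this]
      exact Finset.sum_congr rfl fun b _ => Finset.sum_congr rfl fun k _ => by ring
    · have := hΞ _ ⟨ξ', hξ', rfl⟩
      rw [← this]
      simp only [Φ_is, ξLin, LinearMap.coe_mk, AddHom.coe_mk, Finset.sum_apply, Pi.smul_apply,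
        smul_eq_mul]
      push_cast
      simp only [Finset.sum_mul, Finset.mul_sum]
      rw [Finset.sum_comm]
      exact Finset.sum_congr rfl fun e _ => Finset.sum_congr rfl fun k _ => by ring

/-- `Lie K₀ ⊆ Lie K`. [folklore] -/
theorem tangent_le_pull (D' : SubgroupData (Fin Q.nA) Q.B' (Fin Q.nΞ) Q.cls' Q.κM') :
    D₀.tangent ≤ (Q.pull D').tangent := by
  intro w hw
  rw [← comap_tangent, Submodule.mem_comap, (Q.Φ_eq_zero_iff w).mpr hw]
  exact Submodule.zero_mem _

/-- `K ≠ M` if `K/K₀ ≠ M/K₀`. [folklore] -/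
theorem pull_ne_top {D' : SubgroupData (Fin Q.nA) Q.B' (Fin Q.nΞ) Q.cls' Q.κM'}
    (h : D'.tangent ≠ ⊤) : (Q.pull D').tangent ≠ ⊤ := by
  intro htop
  apply h
  rw [eq_top_iff]
  intro x _
  obtain ⟨w, rfl⟩ := Q.Φ_surjective x
  have : w ∈ (Q.pull D').tangent := by rw [htop]; exact Submodule.mem_top
  rw [← comap_tangent, Submodule.mem_comap] at this
  exact this

/-! #### Algebraic points and the kernel under `Φ` -/

/-- A sum against a row of the joint block family only sees the blocks of its class. [folklore] -/
theorem sum_cvv_eq_sum_filter (f : γ → ℂ) (b : Q.B') :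
    ∑ k, (Q.cvv b k : ℂ) * f k =
      ∑ k ∈ Finset.univ.filter (fun k => cls k = b.1), (Q.cvv b k : ℂ) * f k := by
  classical
  rw [Finset.sum_filter]
  refine Finset.sum_congr rfl fun k _ => ?_
  split_ifs with h
  · rfl
  · simp [Q.cvv_supp h]

/-- `Φ` maps `AlgTors(M)` into `AlgTors(M/K₀)`: the new `z`-coordinates of class `i` are integer
combinations of old `z`-coordinates of class `i` only. [folklore] -/
theorem Φ_mem_AlgTors {L : J → PeriodPair}
    (hL : ∀ i, IsAlgebraic ℚ (L i).g₂ ∧ IsAlgebraic ℚ (L i).g₃)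
    {w : β ⊕ (γ ⊕ δ) → ℂ} (hw : w ∈ AlgTors L cls κM) : Q.Φ w ∈ AlgTors L Q.cls' Q.κM' := by
  classical
  obtain ⟨⟨hy, t, hzt, hs⟩, htor⟩ := hw
  refine ⟨⟨fun j => ?_, fun b => ∑ k, (Q.cvv b k : ℂ) * t k, fun b => ?_, fun e => ?_⟩,
    fun b => ?_⟩
  · rw [Φ_iy, Complex.exp_sum]
    refine Finset.prod_induction _ (fun x => IsAlgebraic ℚ x) (fun a b ha hb => ha.mul hb)
      isAlgebraic_one fun i _ => ?_
    rw [Complex.exp_int_mul]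
    exact isAlgebraic_zpow (hy i) _
  · rw [Φ_iz]
    dsimp only
    rw [Q.sum_cvv_eq_sum_filter, Q.sum_cvv_eq_sum_filter]
    refine PeriodPair.IsUnivExtAlgPoint.sum_int_mul (hL b.1).1 (hL b.1).2 _ _ _ _ fun k hk => ?_
    have hk' : cls k = b.1 := (Finset.mem_filter.mp hk).2
    show (L b.1).IsUnivExtAlgPoint (w (iz k)) (t k)
    rw [← hk']
    exact hzt k
  · rw [Φ_is]
    have hκ : ∀ k, (∑ e', (Q.ξv e e' : ℂ) * (κM e' k : ℂ)) =
        ∑ b, (Q.κM' e b : ℂ) * (Q.cvv b k : ℂ) := by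
      intro k
      have := congrArg (algebraMap Kbar ℂ) (Q.κM'_spec e k)
      simpa [map_sum, map_mul, cvv] using this
    have e1 : ∑ e', (Q.ξv e e' : ℂ) * w (is e') - ∑ b, (Q.κM' e b : ℂ) * ∑ k, (Q.cvv b k : ℂ) * t k =
        ∑ e', (Q.ξv e e' : ℂ) * (w (is e') - ∑ k, (κM e' k : ℂ) * t k) := by
      have e2 : ∑ b, (Q.κM' e b : ℂ) * ∑ k, (Q.cvv b k : ℂ) * t k =
          ∑ k, (∑ b, (Q.κM' e b : ℂ) * (Q.cvv b k : ℂ)) * t k := by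
        simp only [Finset.mul_sum, Finset.sum_mul]
        rw [Finset.sum_comm]
        exact Finset.sum_congr rfl fun k _ => Finset.sum_congr rfl fun b _ => by ring
      have e3 : ∑ e', (Q.ξv e e' : ℂ) * (w (is e') - ∑ k, (κM e' k : ℂ) * t k) =
          ∑ e', (Q.ξv e e' : ℂ) * w (is e') -
            ∑ k, (∑ e', (Q.ξv e e' : ℂ) * (κM e' k : ℂ)) * t k := by
        simp only [mul_sub, Finset.sum_sub_distrib, Finset.mul_sum, Finset.sum_mul]
        congr 1
        rw [Finset.sum_comm]
        exact Finset.sum_congr rfl fun k _ => Finset.sum_congr rfl fun e' _ => by ring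
      rw [e2, e3]
      simp only [hκ]
    rw [e1]
    refine Finset.sum_induction _ (fun x => IsAlgebraic ℚ x) (fun a b ha hb => ha.add hb)
      isAlgebraic_zero fun e' _ => ?_
    exact (mem_algebraicClosure_iff.mp (Q.ξv e e').2).mul (hs e')
  · rw [Φ_iz, Q.sum_cvv_eq_sum_filter]
    refine PeriodPair.IsTorsionPt.sum_int_mul _ _ _ fun k hk => ?_
    have hk' : cls k = b.1 := (Finset.mem_filter.mp hk).2
    show (L b.1).IsTorsionPt (w (iz k))
    rw [← hk']
    exact htor k

/-- **Lifting the kernel** (unimodularity of the joint block family): if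
`Φ w ∈ ker(exp_{M/K₀})` then `w ∈ ker(exp_M) + Lie K₀`. [folklore] -/
theorem exists_ker_of_Φ_mem_ker {L : J → PeriodPair} {w : β ⊕ (γ ⊕ δ) → ℂ}
    (hw : Q.Φ w ∈ ker L Q.cls' Q.κM') : ∃ k ∈ ker L cls κM, w - k ∈ D₀.tangent := by
  obtain ⟨hy, m', n', hz, hs⟩ := hw
  choose p' hp' using hy
  obtain ⟨p, hp⟩ := Q.qv_unimod p'
  obtain ⟨m, hm⟩ := Q.cvv_unimod m'
  obtain ⟨n, hn⟩ := Q.cvv_unimod n'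
  refine ⟨coords (fun i => (p i : ℂ) * (2 * Real.pi * I))
    (fun k => (m k : ℂ) * (L (cls k)).ω₁ + (n k : ℂ) * (L (cls k)).ω₂)
    (fun e' => ∑ k, (κM e' k : ℂ) * ((m k : ℂ) * (L (cls k)).η₁ + (n k : ℂ) * (L (cls k)).η₂)),
    ⟨fun i => ⟨p i, rfl⟩, m, n, fun k => rfl, fun e' => rfl⟩, ?_⟩
  rw [← Q.Φ_eq_zero_iff, map_sub, sub_eq_zero]
  funext s
  rcases s with j | b | e
  · show Q.Φ w (iy j) = Q.Φ _ (iy j)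
    rw [hp' j, Φ_iy]
    simp only [coords_iy]
    have := congrArg (fun x : ℤ => (x : ℂ)) (hp j)
    push_cast at this
    rw [← this, Finset.sum_mul]
    exact Finset.sum_congr rfl fun i _ => by ring
  · show Q.Φ w (iz b) = Q.Φ _ (iz b)
    rw [hz b, Φ_iz]
    simp only [coords_iz]
    rw [Q.sum_cvv_cls L PeriodPair.ω₁ PeriodPair.ω₂ m n b, hm b, hn b]
  · show Q.Φ w (is e) = Q.Φ _ (is e)
    rw [hs e, Φ_is]
    simp only [coords_is]
    have hκ : ∀ k, (∑ e', (Q.ξv e e' : ℂ) * (κM e' k : ℂ)) =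
        ∑ b, (Q.κM' e b : ℂ) * (Q.cvv b k : ℂ) := by
      intro k
      have := congrArg (algebraMap Kbar ℂ) (Q.κM'_spec e k)
      simpa [map_sum, map_mul, cvv] using this
    -- both sides equal `∑_k (∑_e' ξv e e' κ e' k) (m_k η₁ + n_k η₂)(Λ_{cls k})`
    have lhs : ∑ b, (Q.κM' e b : ℂ) * (m' b * (L (Q.cls' b)).η₁ + n' b * (L (Q.cls' b)).η₂) =
        ∑ k, (∑ b, (Q.κM' e b : ℂ) * (Q.cvv b k : ℂ)) *
          ((m k : ℂ) * (L (cls k)).η₁ + (n k : ℂ) * (L (cls k)).η₂) := by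
      have e1 : ∀ b, (m' b : ℂ) * (L (Q.cls' b)).η₁ + n' b * (L (Q.cls' b)).η₂ =
          ∑ k, (Q.cvv b k : ℂ) * ((m k : ℂ) * (L (cls k)).η₁ + (n k : ℂ) * (L (cls k)).η₂) := by
        intro b
        rw [Q.sum_cvv_cls L PeriodPair.η₁ PeriodPair.η₂ m n b, hm b, hn b]
      simp only [e1, Finset.mul_sum, Finset.sum_mul]
      rw [Finset.sum_comm]
      exact Finset.sum_congr rfl fun k _ => Finset.sum_congr rfl fun b _ => by ring
    have rhs : ∑ e', (Q.ξv e e' : ℂ) *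
        ∑ k, (κM e' k : ℂ) * ((m k : ℂ) * (L (cls k)).η₁ + (n k : ℂ) * (L (cls k)).η₂) =
        ∑ k, (∑ e', (Q.ξv e e' : ℂ) * (κM e' k : ℂ)) *
          ((m k : ℂ) * (L (cls k)).η₁ + (n k : ℂ) * (L (cls k)).η₂) := by
      simp only [Finset.mul_sum, Finset.sum_mul]
      rw [Finset.sum_comm]
      exact Finset.sum_congr rfl fun k _ => Finset.sum_congr rfl fun e' _ => by ring
    rw [lhs, rhs]
    simp only [hκ]

/-! #### The transport theorem (borderline quotients) -/

/-- **Transport to the quotient by a borderline subgroup.** Let `𝔟 ⊊ Lie M` be `ℚ̄`-rational and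
semistable, and `K₀ ≠ M` a connected algebraic subgroup which is BORDERLINE for `𝔟`:
`dim 𝔟·(n - dim 𝔨₀) = (dim 𝔟 - dim(𝔟 ∩ 𝔨₀))·n`. Then `Φ(𝔟) ⊆ Lie(M/K₀)` is `ℚ̄`-rational,
proper, and semistable in `M/K₀` (modular law and the mediant inequality; verbatim from
`GaGmE.Std.QuotData.transport`).
[cite: BakerWustholz2007, §6.7 (index), §6.8 (p. 115: "Clearly π_* 𝔟 is semistable")] -/
theorem transport {𝔟 : Submodule ℂ (β ⊕ (γ ⊕ δ) → ℂ)}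
    (hrat : LiePresentation.IsKRational Kbar 𝔟) (h𝔟 : 𝔟 ≠ ⊤)
    (hss : Semistable cls κM 𝔟) (hD₀ : D₀.tangent ≠ ⊤)
    (hbord : finrank ℂ 𝔟 * (Fintype.card (β ⊕ (γ ⊕ δ)) - finrank ℂ D₀.tangent) =
      (finrank ℂ 𝔟 - finrank ℂ ↥(𝔟 ⊓ D₀.tangent)) * Fintype.card (β ⊕ (γ ⊕ δ))) :
    LiePresentation.IsKRational Kbar (𝔟.map Q.Φ) ∧ 𝔟.map Q.Φ ≠ ⊤ ∧
      Semistable Q.cls' Q.κM' (𝔟.map Q.Φ) := by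
  set n := Fintype.card (β ⊕ (γ ⊕ δ)) with hn
  set d := finrank ℂ 𝔟 with hd
  set k := finrank ℂ D₀.tangent with hk
  set i₀ := finrank ℂ ↥(𝔟 ⊓ D₀.tangent) with hi₀
  set 𝔟' : Submodule ℂ (Q.σ' → ℂ) := 𝔟.map Q.Φ with h𝔟'
  have hcard : n = Fintype.card Q.σ' + k := Q.card_eq
  have hcomap : 𝔟'.comap Q.Φ = 𝔟 ⊔ D₀.tangent := Q.comap_map 𝔟
  -- dimensions
  have hsup : finrank ℂ ↥(𝔟 ⊔ D₀.tangent) + i₀ = d + k :=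
    Submodule.finrank_sup_add_finrank_inf_eq 𝔟 D₀.tangent
  have hdim𝔟' : finrank ℂ 𝔟' + k = finrank ℂ ↥(𝔟 ⊔ D₀.tangent) := by
    rw [← hcomap]; exact (Q.finrank_comap 𝔟').symm
  have hdlt : d < n := by
    have := Submodule.finrank_lt h𝔟; simpa [hn, hd] using this
  have hklt : k < n := by
    have := Submodule.finrank_lt hD₀; simpa [hn, hk] using this
  have hi₀d : i₀ ≤ d := Submodule.finrank_mono inf_le_left
  have hi₀k : i₀ ≤ k := Submodule.finrank_mono inf_le_right
  have hsuple : finrank ℂ ↥(𝔟 ⊔ D₀.tangent) ≤ n := by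
    have := Submodule.finrank_le (𝔟 ⊔ D₀.tangent); simpa [hn] using this
  -- (T1) rationality
  have h1 : LiePresentation.IsKRational Kbar 𝔟' := Q.isKRational_map hrat
  -- (T2) properness: `𝔟 + 𝔨₀ = Lie M` would contradict the borderline equality
  have h2 : 𝔟' ≠ ⊤ := by
    intro htop
    have hfull : finrank ℂ ↥(𝔟 ⊔ D₀.tangent) = n := by
      rw [← hcomap, htop, Submodule.comap_top, finrank_top, Module.finrank_fintype_fun_eq_card]
    rw [hfull] at hsup
    have e1 : (d - i₀) * n = (n - k) * n := by
      congr 1; omega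
    rw [e1] at hbord
    have : (n - k) * d = (n - k) * n := by rw [mul_comm (n - k) d]; exact hbord
    have hnk : n - k = 0 := by
      by_contra hne
      have hpos : 0 < n - k := Nat.pos_of_ne_zero hne
      have := Nat.eq_of_mul_eq_mul_left hpos this
      omega
    omega
  -- (T3) semistability
  have h3 : Semistable Q.cls' Q.κM' 𝔟' := by
    rintro _ ⟨D', rfl⟩ h𝔨'top
    set P := (Q.pull D').tangent with hP
    have hPtop : P ≠ ⊤ := Q.pull_ne_top h𝔨'top
    have h𝔨₀P : D₀.tangent ≤ P := Q.tangent_le_pull D'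
    have hssP := hss P ⟨Q.pull D', rfl⟩ hPtop
    set kP := finrank ℂ P with hkP
    set iP := finrank ℂ ↥(𝔟 ⊓ P) with hiP
    have hdimK : kP = finrank ℂ ↥D'.tangent + k := by
      rw [hkP, hP, ← Q.comap_tangent]; exact Q.finrank_comap _
    have hmod : (𝔟 ⊔ D₀.tangent) ⊓ P = (𝔟 ⊓ P) ⊔ D₀.tangent := by
      rw [sup_comm 𝔟 D₀.tangent, sup_comm (𝔟 ⊓ P) D₀.tangent]
      exact sup_inf_assoc_of_le 𝔟 h𝔨₀P
    have hinf2 : (𝔟 ⊓ P) ⊓ D₀.tangent = 𝔟 ⊓ D₀.tangent := by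
      rw [inf_assoc, inf_eq_right.mpr h𝔨₀P]
    have hsup2 : finrank ℂ ↥((𝔟 ⊓ P) ⊔ D₀.tangent) + i₀ = iP + k := by
      have := Submodule.finrank_sup_add_finrank_inf_eq (𝔟 ⊓ P) D₀.tangent
      rwa [hinf2] at this
    have hdimI : finrank ℂ ↥(𝔟' ⊓ D'.tangent) + k = finrank ℂ ↥((𝔟 ⊓ P) ⊔ D₀.tangent) := by
      rw [← hmod, ← hcomap, hP, ← Q.comap_tangent, ← Submodule.comap_inf]
      exact (Q.finrank_comap _).symm
    set d' := finrank ℂ 𝔟' with hd'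
    set k' := finrank ℂ ↥D'.tangent with hk'
    set i' := finrank ℂ ↥(𝔟' ⊓ D'.tangent) with hi'
    set n' := Fintype.card Q.σ' with hn'
    have hd'eq : d' + i₀ = d := by omega
    have hi'eq : i' + i₀ = iP := by omega
    have hiPd : iP ≤ d := Submodule.finrank_mono inf_le_left
    have hkPn : kP ≤ n := by have := Submodule.finrank_le P; simpa [hn] using this
    change d * (n - kP) ≤ (d - iP) * n at hssP
    show d' * (n' - k') ≤ (d' - i') * n'
    have hnpos : 0 < n := by omega
    have key : n * (d' * (n' - k')) ≤ n * ((d' - i') * n') := by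
      have e1 : n * (d' * (n' - k')) = ((d - i₀) * n) * (n - kP) := by
        have : n' - k' = n - kP := by omega
        rw [this, show d' = d - i₀ by omega]; ring
      have e2 : n * ((d' - i') * n') = (n - k) * ((d - iP) * n) := by
        have : d' - i' = d - iP := by omega
        rw [this, show n' = n - k by omega]; ring
      rw [e1, e2, ← hbord]
      calc d * (n - k) * (n - kP) = (n - k) * (d * (n - kP)) := by ring
        _ ≤ (n - k) * ((d - iP) * n) := Nat.mul_le_mul_left _ hssP
    exact Nat.le_of_mul_le_mul_left key hnpos
  exact ⟨h1, h2, h3⟩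

/-! #### CM classes keep at most one block in the quotient -/

/-- **If the CM classes carry at most one block of `M`, they carry at most one block of `M/K₀`.**
The classwise bases `c⁽ⁱ,ᵇ⁾` are supported in `cls⁻¹(i)`; if this fibre has at most one element
`k₀`, unimodularity of `(c⁽ⁱ,ᵇ⁾)_b` (integer values `1` at `b` and `0` at `b' ≠ b` are attained
simultaneously) forces `nᵢ ≤ 1`. [folklore] -/
theorem cls'_eq_imp {L : J → PeriodPair}
    (hcm1 : ∀ b b' : γ, cls b = cls b' → (L (cls b)).HasCM → b = b') :
    ∀ b b' : Q.B', Q.cls' b = Q.cls' b' → (L (Q.cls' b)).HasCM → b = b' := by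
  classical
  rintro ⟨i, j⟩ ⟨i', j'⟩ h hCM
  change i = i' at h
  subst h
  change (L i).HasCM at hCM
  by_contra hne
  have hjj : j ≠ j' := fun h => hne (by subst h; rfl)
  -- unimodularity at `e_j`: `∑ c⁽ⁱ,ʲ⁾ p = 1`, `∑ c⁽ⁱ,ʲ'⁾ p = 0`
  obtain ⟨p, hp⟩ := Q.cv_unimod i (Pi.single j 1)
  have hp1 : ∑ k, Q.cv i j k * p k = 1 := by rw [hp j]; simp
  have hp0 : ∑ k, Q.cv i j' k * p k = 0 := by rw [hp j']; simp [Ne.symm hjj]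
  obtain ⟨p', hp'⟩ := Q.cv_unimod i (Pi.single j' 1)
  have hp'1 : ∑ k, Q.cv i j' k * p' k = 1 := by rw [hp' j']; simp
  -- all sums reduce to the (at most one) block `k₀` of class `i`
  by_cases hex : ∃ k₀, cls k₀ = i
  · obtain ⟨k₀, hk₀⟩ := hex
    have huniq : ∀ k, cls k = i → k = k₀ := fun k hk =>
      hcm1 k k₀ (by rw [hk, hk₀]) (by rw [hk]; exact hCM)
    have hred : ∀ (v : γ → ℤ) (q : γ → ℤ), (∀ k, cls k ≠ i → v k = 0) →
        ∑ k, v k * q k = v k₀ * q k₀ := by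
      intro v q hv
      rw [Finset.sum_eq_single k₀]
      · intro k _ hk
        rw [hv k (fun h => hk (huniq k h)), zero_mul]
      · intro h; exact absurd (Finset.mem_univ k₀) h
    rw [hred _ _ (Q.cv_supp i j)] at hp1
    rw [hred _ _ (Q.cv_supp i j')] at hp0 hp'1
    have hpk : p k₀ ≠ 0 := fun h => by rw [h, mul_zero] at hp1; exact zero_ne_one hp1
    have hv0 : Q.cv i j' k₀ = 0 := (mul_eq_zero.mp hp0).resolve_right hpk
    rw [hv0, zero_mul] at hp'1
    exact zero_ne_one hp'1
  · push Not at hex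
    have : ∑ k, Q.cv i j k * p k = 0 :=
      Finset.sum_eq_zero fun k _ => by rw [Q.cv_supp i j k (hex k), zero_mul]
    rw [this] at hp1
    exact zero_ne_one hp1

end QuotData

end Quot

end Std

end GaGmEFam

end Literature.NumberTheory.Transcendental

end
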